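import Literature.NumberTheory.PAdicHodge.BmaxPlusFormalLogThetaFrobenius
import Literature.NumberTheory.PAdicHodge.BmaxPlusFormalLogDivisionTowerElliptic
import Literature.NumberTheory.PAdicHodge.AinfWeierstrassHodgeTateNonvanishing
import HarnessLib

/-!
# The `φ`-partner of the `A_max`-period is NOT in `ker θ`: `θ(φ L_τ) ≠ 0` for the formal group of a supersingular elliptic curve

Topic `Literature/NumberTheory/PAdicHodge`; namespace `Literature.NumberTheory.PAdicHodge.AinfTop`. THEOREMS ONLY (no definition, no named
fact, no instance, no `sorry`). The NON-DEGENERACY of the φ-road's crystalline pair `(L_τ, φL_τ)` on `T_pŴ` (line `kato_lever`, crux K★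
`stmt-BirchSwinnertonDyer-22226`, B8b; memo `Summits/…/Cruxes/StarredOptimalManinUnitFiveSeven/Lines/kato-lever-K2-tower-instantiation.md` §3): the
socket's hypothesis `hnot : ∃ τ, Pη(τ) ∉ Fil¹` for `Pη := (B_max⁺ → B_dR⁺) ∘ φ ∘ L`, i.e. «Frobenius does not preserve the Hodge filtration».

* §1 ★ `not_uAinf_dvd_torsionLift` — for `W/ℤ` with good SUPERSINGULAR reduction at `p ≥ 5` and a Tate-module point `τ` with `‖p‖ < ‖u₁‖`:
  **`([ε] − 1) ∤ [τ̃]` in `𝔸_inf`**. Tilt proof, as in `AinfWeierstrassHodgeTateNonvanishing.torsionLift_not_mem_span_xi_sq`: `[τ̃] = p·R(T₁) + T₁^{p²}·(unit)`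
  reduces modulo `p` to `T̄₁^{p²}·(unit)` with `‖T̄₁♯‖ = ‖u₁‖`; `([ε] − 1)` reduces to `ε − 1` with `‖(ε−1)♯‖^{p−1} = ‖p‖^p`
  (`norm_untilt_eps_sub_one_pow`); divisibility would give `‖u₁‖^{p²(p−1)} ≤ ‖p‖^p ≤ ‖u₁‖^{p(p²−1)}`, impossible for `0 < ‖u₁‖ < 1`.
* §2 ★★★ `thetaBmaxPlus_frobBmaxPlus_logSum_ne_zero` — for such `τ`, ANY Honda type (`he`) and any witness `z` (`ι[τ̃] = p·z`):
  **`θ_max(φ Λ_1(ι[τ̃], z)) ≠ 0`** (`BmaxPlusFormalLogThetaFrobenius.uAinf_dvd_of_thetaBmaxPlus_frobBmaxPlus_logSum_eq_zero` + §1 + the exact relation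
  `BmaxPlusFormalLogDivisionTower.frobBmaxPlus_honda_logSum_divisionLiftPt_eq_zero`); `formalLogNum_one` (`b₁ = 1`).
* §3 ★★★ `exists_thetaBmaxPlus_frobBmaxPlus_logSum_ne_zero` — the WITNESS: some `τ ∈ T_pŴ(𝒪_{ℂ_F})` and witness `z` with
  `θ_max(φ L_τ) ≠ 0`, `L_τ = Λ_1(ι[τ̃], z)`, `a = a_p` (`exists_tatePt_norm_p_lt_norm_pow`).

So for good supersingular reduction (`p ≥ 5`) the map `τ ↦ φL_τ` is not `ker θ`-valued: under the comparison `B_max⁺ → B_dR⁺` the φ-road's `Pη`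
leaves `Fil¹` — Tate's theorem «`T_p ⊗ ℂ → Lie` is onto» read through Frobenius, without `B_cris`. Infrastructure only; BSD / K★ are not proved by
any of this.

## References
* J. Tate, *p-divisible groups* (1967), §4. [Tate1967]
* J.-M. Fontaine, *Le corps des périodes p-adiques*, Astérisque 223 (1994), Exp. II §1.2–1.5, Exp. III Prop. 5.1.3. [FontaineAsterisque223III]
* P. Colmez, *Périodes p-adiques des variétés abéliennes*, Math. Ann. 292 (1992), §2. [Colmez1992PeriodesAbeliennes]
-/

noncomputable section

open PowerSeries

namespace Literature.NumberTheory.PAdicHodge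

open Literature Literature.NumberTheory.GaloisRepresentations Literature.NumberTheory.EllipticCurves WeierstrassCurve
open Literature.NumberTheory.GaloisRepresentations.IsNonarchimedeanLocalField Literature.NumberTheory.GaloisRepresentations.LubinTate
open Literature.RingTheory.FormalGroups

namespace AinfTop

variable {F : Type} [Field F] [ValuativeRel F] [TopologicalSpace F] [IsNonarchimedeanLocalField F] [CharZero F]
  {p : ℕ} [Fact p.Prime] [Fact (¬ IsUnit (p : integerC F))] [IsAdicComplete (Ideal.span {(p : integerC F)}) (integerC F)]
  {hθ : Function.Surjective (WittVector.fontaineTheta (integerC F) p)} (W : WeierstrassCurve ℤ)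

/-! ## §1 `([ε] − 1) ∤ [τ̃]` -/

omit [CharZero F] [Fact (¬ IsUnit (p : integerC F))] [IsAdicComplete (Ideal.span {(p : integerC F)}) (integerC F)] [Fact p.Prime] in
/-- A unit of `𝒪_{ℂ_F}` has norm `1`. [folklore] -/
private theorem norm_coe_eq_one_of_isUnit' {u : integerC F} (hu : IsUnit u) : ‖(u : CompletedAlgClosure F)‖ = 1 := by
  obtain ⟨v, rfl⟩ := hu
  have h1 : ‖((v : integerC F) : CompletedAlgClosure F)‖ ≤ 1 := norm_coe_integerC_le _
  have h2 : ‖(((v⁻¹ : (integerC F)ˣ) : integerC F) : CompletedAlgClosure F)‖ ≤ 1 := norm_coe_integerC_le _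
  have h3 : ‖((v : integerC F) : CompletedAlgClosure F)‖ * ‖(((v⁻¹ : (integerC F)ˣ) : integerC F) : CompletedAlgClosure F)‖ = 1 := by
    rw [← norm_mul, ← Subring.coe_mul, Units.mul_inv, Subring.coe_one, norm_one]
  by_contra hne
  have hlt := lt_of_le_of_ne h1 hne
  exact absurd h3 (ne_of_lt (mul_lt_one_of_nonneg_of_lt_one_left (norm_nonneg _) hlt h2))

set_option maxHeartbeats 1600000 in
/-- ★ **`([ε] − 1) ∤ [τ̃]`** for a Tate-module point `τ` of the formal group of `W/ℤ` with good SUPERSINGULAR reduction at `p ≥ 5` and `‖p‖ < ‖u₁‖`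
(`u₁ = τ₁`). As in `torsionLift_not_mem_span_xi_sq`: `[τ̃] = [p]_W(T₁) = p·R(T₁) + T₁^{p²}·s` with `s` a unit; modulo `p`, `[τ̃]‾ = T̄₁^{p²}·s̄` in `𝒪♭`,
`‖T̄₁♯‖ = ‖u₁‖`, and `‖p‖·‖u₁‖ ≤ ‖u₁‖^{p²}`. If `[τ̃] = ([ε] − 1)·y` then `[τ̃]‾ = (ε − 1)·ȳ`, so `‖u₁‖^{p²} ≤ ‖(ε − 1)♯‖` with
`‖(ε − 1)♯‖^{p−1} = ‖p‖^p` (`norm_untilt_eps_sub_one_pow`): `‖u₁‖^{p²(p−1)} ≤ ‖p‖^p ≤ ‖u₁‖^{p(p²−1)}` and `p²(p−1) < p(p²−1)` — impossible for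
`0 < ‖u₁‖ < 1`. [cite: Tate1967, §4] [cite: FontaineAsterisque223III, Exp. II §1.2–1.5] -/
theorem not_uAinf_dvd_torsionLift (hp5 : 5 ≤ p) (hΔ : ¬ (p : ℤ) ∣ W.Δ)
    (hA : (W.map (Int.castRingHom (ZMod p))).hasseCoeff p = 0) (τ : TatePt F p W)
    (h₁ : ‖(p : CompletedAlgClosure F)‖ < ‖(((seq W τ 1 : (maxNilIdealC F).toIdeal) : CBall F) : CompletedAlgClosure F)‖) :
    ¬ (uAinf : Ainf (p := p) F) ∣ (of F p).symm (torsionLift W hθ (seq W τ) (mulPC_seq W τ)) := by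
  have hp : p.Prime := Fact.out
  have hp2 : p ≠ 2 := by omega
  intro hdvd
  obtain ⟨R, S, hRS, hR0, hR1, hS0⟩ := exists_formalMul_prime_eq_of_hasseCoeff_eq_zero W hp2 hA
  -- notation
  set u : (maxNilIdealC F).toIdeal := seq W τ 1 with hu
  set x : CompletedAlgClosure F := ((u : CBall F) : CompletedAlgClosure F) with hx
  set T : (nilTheta F p hθ).toIdeal := torsionLiftShiftPt W hθ (seq W τ) (mulPC_seq W τ) 1 with hT
  have hθT : theta F p (T : AinfTop F p) = u := by rw [hT, coe_torsionLiftShiftPt, theta_torsionLiftShift]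
  have hτT : torsionLift W hθ (seq W τ) (mulPC_seq W τ) = (mulP W T : AinfTop F p) := by
    rw [hT, mulP_torsionLiftShiftPt, torsionLiftShift_zero]
  have hpC : 0 < ‖(p : CompletedAlgClosure F)‖ := by
    refine norm_pos_iff.2 fun h0 => ?_
    rw [← map_natCast (algebraMap F (CompletedAlgClosure F)), _root_.map_eq_zero] at h0
    exact (Nat.cast_ne_zero.2 hp.ne_zero) h0
  have hp1 : ‖(p : CompletedAlgClosure F)‖ < 1 := norm_natCast_C_lt_one'
  have hxp : ‖(p : CompletedAlgClosure F)‖ < ‖x‖ := h₁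
  have hx1 : ‖x‖ < 1 := u.2
  have hxpos : 0 < ‖x‖ := hpC.trans hxp
  -- (A) `[p](u) = 0` gives `‖p‖·‖u‖ ≤ ‖u‖^{p²}`
  have hpu0 : ((mulPC F p W u : (maxNilIdealC F).toIdeal) : CBall F) = 0 := by rw [hu, mulPC_seq, seq_zero]
  obtain ⟨R', hR'⟩ := PowerSeries.X_dvd_iff.mpr hR0
  have hR'0 : constantCoeff R' = 1 := by
    have h := congrArg (coeff 1) hR'
    rw [hR1, PowerSeries.coeff_succ_X_mul, coeff_zero_eq_constantCoeff] at h
    exact h.symm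
  obtain ⟨R₁, hR₁⟩ := PowerSeries.X_dvd_iff.mpr (show constantCoeff (R' - 1) = 0 by rw [map_sub, hR'0, map_one, sub_self])
  have hRu : (evalAt (maxNilIdealC F) u R : CompletedAlgClosure F) =
      x * (1 + (evalAt (maxNilIdealC F) u (X * R₁) : CompletedAlgClosure F)) := by
    have hR'' : R = X * (1 + X * R₁) := by rw [← hR₁, add_sub_cancel, hR']
    rw [hR'', map_mul, map_add, map_one, evalAt_maxNilIdealC_X, Subring.coe_mul, Subring.coe_add, Subring.coe_one]
  have hsmall : ‖((evalAt (maxNilIdealC F) u (X * R₁) : CBall F) : CompletedAlgClosure F)‖ < 1 :=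
    lt_of_le_of_lt (NumberTheory.EllipticCurves.norm_evalAt_le_of_constantCoeff u
      (by rw [map_mul, constantCoeff_X, zero_mul])) hx1
  have hone : ‖(1 : CompletedAlgClosure F) + (evalAt (maxNilIdealC F) u (X * R₁) : CompletedAlgClosure F)‖ = 1 := by
    rw [IsUltrametricDist.norm_add_eq_max_of_norm_ne_norm (by rw [norm_one]; exact (ne_of_lt hsmall).symm), norm_one,
      max_eq_left hsmall.le]
  have hnormR : ‖(evalAt (maxNilIdealC F) u R : CompletedAlgClosure F)‖ = ‖x‖ := by
    rw [hRu, norm_mul, hone, mul_one]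
  have heval := coe_mulPC_eq_of_decomp W hRS u
  rw [hpu0] at heval
  have hS1 : ‖((evalAt (maxNilIdealC F) u S : CBall F) : CompletedAlgClosure F)‖ ≤ 1 :=
    NumberTheory.EllipticCurves.norm_coe_unitBall_le_one _
  have hkey : ‖(p : CompletedAlgClosure F)‖ * ‖x‖ ≤ ‖x‖ ^ (p ^ 2) := by
    have h1 : ((p : CBall F) : CompletedAlgClosure F) * (evalAt (maxNilIdealC F) u R : CompletedAlgClosure F) =
        -(x ^ (p ^ 2) * (evalAt (maxNilIdealC F) u S : CompletedAlgClosure F)) := by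
      have h := congrArg (fun z : CBall F => (z : CompletedAlgClosure F)) heval
      simp only [Subring.coe_add, Subring.coe_mul, SubmonoidClass.coe_pow, Subring.coe_zero] at h
      exact eq_neg_of_add_eq_zero_left h.symm
    have h2 := congrArg (fun z => ‖z‖) h1
    simp only [norm_mul, norm_neg, norm_pow, hnormR, Subring.coe_natCast] at h2
    rw [h2]
    exact mul_le_of_le_one_right (pow_nonneg (norm_nonneg _) _) hS1
  -- (B) `[τ] = p·R(T) + T^{p²}·(unit)` in `𝔸_inf`
  set c : ℤ := coeff (p ^ 2) (W.formalMul p) with hc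
  obtain ⟨m, hm⟩ := prime_dvd_coeff_sq_formalMul_add_one W hp5 hΔ hA
  obtain ⟨S₁, hS₁⟩ := PowerSeries.X_dvd_iff.mpr (show PowerSeries.constantCoeff (S - C c) = 0 by
    rw [map_sub, hS0, PowerSeries.constantCoeff_C, sub_self])
  have hS : S = C c + X * S₁ := by rw [← hS₁, add_sub_cancel]
  haveI : IsAdicComplete (WithIdeal.i : Ideal (AinfTop F p)) (AinfTop F p) := isAdicComplete_span_p_xi (F := F) (p := p)
  have hpJ : (p : AinfTop F p) ∈ (⊥ : Ideal (AinfTop F p)).jacobson :=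
    IsAdicComplete.le_jacobson_bot (WithIdeal.i : Ideal (AinfTop F p))
      (by rw [ideal_eq]; exact Ideal.subset_span (Set.mem_insert _ _))
  have hcu : IsUnit ((c : ℤ) : AinfTop F p) := by
    have h1 : IsUnit ((p : AinfTop F p) * (-(m : AinfTop F p)) + 1) := Ideal.mem_jacobson_bot.1 hpJ _
    have h2 : ((c : ℤ) : AinfTop F p) = -((p : AinfTop F p) * (-(m : AinfTop F p)) + 1) := by
      have h3 : (c : ℤ) = p * m - 1 := by linarith
      rw [h3]; push_cast; ring
    rw [h2]; exact h1.neg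
  have haJ : (T : AinfTop F p) ∈ (⊥ : Ideal (AinfTop F p)).jacobson := mem_jacobson_bot_of_mem_nilTheta T.2
  have hevalT : (mulP W T : AinfTop F p) = (p : AinfTop F p) * evalAt (nilTheta F p hθ) T R +
      (T : AinfTop F p) ^ (p ^ 2) * ((c : AinfTop F p) + (T : AinfTop F p) * evalAt (nilTheta F p hθ) T S₁) := by
    rw [mulP, coe_evalPt₁_eq_evalAt, hRS, hS, map_add, map_mul, map_mul, map_add, map_mul, map_pow, evalAt_nilTheta_X,
      evalAt_nilTheta_C, evalAt_nilTheta_C, Int.cast_natCast]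
  have hunit : IsUnit ((c : AinfTop F p) + (T : AinfTop F p) * evalAt (nilTheta F p hθ) T S₁) := by
    obtain ⟨cu, hcu'⟩ := hcu
    have h1 : IsUnit ((T : AinfTop F p) * (evalAt (nilTheta F p hθ) T S₁ * ↑cu⁻¹) + 1) := Ideal.mem_jacobson_bot.1 haJ _
    have h2 : (c : AinfTop F p) + (T : AinfTop F p) * evalAt (nilTheta F p hθ) T S₁ =
        (cu : AinfTop F p) * ((T : AinfTop F p) * (evalAt (nilTheta F p hθ) T S₁ * ↑cu⁻¹) + 1) := by
      rw [show (cu : AinfTop F p) * ((T : AinfTop F p) * (evalAt (nilTheta F p hθ) T S₁ * ↑cu⁻¹) + 1) =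
        (T : AinfTop F p) * evalAt (nilTheta F p hθ) T S₁ * ((cu : AinfTop F p) * ↑cu⁻¹) + cu by ring,
        Units.mul_inv, mul_one, hcu', add_comm]
    rw [h2]; exact (Units.isUnit cu).mul h1
  obtain ⟨s, hs⟩ := hunit
  -- (C) reduce modulo `p`: `[τ]‾ = T̄^{p²}·s̄` and `[τ]‾ = (ε − 1)·ȳ`
  set Tb : PreTilt (integerC F) p := WittVector.constantCoeff ((of F p).symm (T : AinfTop F p)) with hTb
  set sb : PreTilt (integerC F) p := WittVector.constantCoeff ((of F p).symm (s : AinfTop F p)) with hsb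
  have hsbu : IsUnit sb := (Units.isUnit s).map ((WittVector.constantCoeff).comp (of F p).symm.toRingHom)
  have hred : WittVector.constantCoeff ((of F p).symm (torsionLift W hθ (seq W τ) (mulPC_seq W τ))) = Tb ^ (p ^ 2) * sb := by
    rw [hτT, hevalT, ← hs]
    simp only [map_add, map_mul, map_pow, map_natCast, CharP.cast_eq_zero, zero_mul, zero_add, hTb, hsb]
  obtain ⟨y, hy⟩ := hdvd
  have hred' : Tb ^ (p ^ 2) * sb = ((eps : PreTilt (integerC F) p) - 1) * WittVector.constantCoeff y := by
    rw [← hred, hy, map_mul, constantCoeff_uAinf]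
  -- (D) untilt and take norms in `ℂ_F`
  have hunt := congrArg (fun z : PreTilt (integerC F) p => ((PreTilt.untilt z : integerC F) : CompletedAlgClosure F)) hred'
  simp only [map_mul, map_pow, Subring.coe_mul, SubmonoidClass.coe_pow] at hunt
  have hnorm := congrArg (fun z => ‖z‖) hunt
  simp only [norm_mul, norm_pow] at hnorm
  have hsb1 : ‖((PreTilt.untilt sb : integerC F) : CompletedAlgClosure F)‖ = 1 :=
    norm_coe_eq_one_of_isUnit' (hsbu.map PreTilt.untilt)
  have hy1 : ‖((PreTilt.untilt (WittVector.constantCoeff y) : integerC F) : CompletedAlgClosure F)‖ ≤ 1 := norm_coe_integerC_le _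
  rw [hsb1, mul_one] at hnorm
  -- `‖T̄♯‖ = ‖u₁‖`
  have hTu : ‖((PreTilt.untilt Tb : integerC F) : CompletedAlgClosure F)‖ = ‖x‖ := by
    have hdiff := fontaineTheta_sub_untilt_constantCoeff_mem ((of F p).symm (T : AinfTop F p))
    obtain ⟨d, hd⟩ := Ideal.mem_span_singleton'.1 hdiff
    have hθx : ((WittVector.fontaineTheta (integerC F) p ((of F p).symm (T : AinfTop F p)) : integerC F) : CompletedAlgClosure F) = x := by
      rw [hx, ← hθT, ← coe_theta]; rfl
    set b : CompletedAlgClosure F := ((PreTilt.untilt Tb : integerC F) : CompletedAlgClosure F) with hbdef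
    have hd' := congrArg (fun z : integerC F => (z : CompletedAlgClosure F)) hd
    simp only [Subring.coe_mul, Subring.coe_natCast, AddSubgroupClass.coe_sub] at hd'
    have hle : ‖x - b‖ ≤ ‖(p : CompletedAlgClosure F)‖ := by
      rw [← hθx, hbdef, hTb, ← hd', norm_mul]
      exact mul_le_of_le_one_left (norm_nonneg _) (norm_coe_integerC_le d)
    have hlt : ‖x - b‖ < ‖x‖ := hle.trans_lt hxp
    have hne : ‖x‖ ≠ ‖-(x - b)‖ := by rw [norm_neg]; exact (ne_of_lt hlt).symm
    have h := IsUltrametricDist.norm_add_eq_max_of_norm_ne_norm hne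
    rw [show x + -(x - b) = b by ring, norm_neg, max_eq_left hlt.le] at h
    exact h
  rw [hTu] at hnorm
  -- the `ε − 1` factor: `E^{p−1} = ‖p‖^p`
  set E : ℝ := ‖((PreTilt.untilt ((eps : PreTilt (integerC F) p) - 1) : integerC F) : CompletedAlgClosure F)‖ with hE
  have hEp : E ^ (p - 1) = ‖(p : CompletedAlgClosure F)‖ ^ p := norm_untilt_eps_sub_one_pow
  -- `‖x‖^{p²} ≤ E`, hence `‖x‖^{p²(p−1)} ≤ ‖p‖^p`
  have hle1 : ‖x‖ ^ (p ^ 2) ≤ E := by rw [hnorm]; exact mul_le_of_le_one_right (norm_nonneg _) hy1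
  have hle2 : ‖x‖ ^ (p ^ 2 * (p - 1)) ≤ ‖(p : CompletedAlgClosure F)‖ ^ p := by
    rw [pow_mul, ← hEp]; exact pow_le_pow_left₀ (pow_nonneg (norm_nonneg _) _) hle1 _
  -- `‖p‖ ≤ ‖x‖^{p²−1}`, hence `‖p‖^p ≤ ‖x‖^{p(p²−1)}`
  have hle3 : ‖(p : CompletedAlgClosure F)‖ ≤ ‖x‖ ^ (p ^ 2 - 1) := by
    have h := hkey
    rw [show p ^ 2 = (p ^ 2 - 1) + 1 from (Nat.sub_add_cancel (Nat.one_le_pow _ _ hp.pos)).symm, pow_succ] at h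
    exact le_of_mul_le_mul_right h hxpos
  have hle4 : ‖(p : CompletedAlgClosure F)‖ ^ p ≤ ‖x‖ ^ ((p ^ 2 - 1) * p) := by
    rw [pow_mul]; exact pow_le_pow_left₀ (norm_nonneg _) hle3 _
  -- but `p²(p−1) < (p²−1)p` and `0 < ‖x‖ < 1`
  have hlt : (p ^ 2 * (p - 1)) < ((p ^ 2 - 1) * p) := by
    have h5 : 2 ≤ p := hp.two_le
    have e1 : p ^ 2 * (p - 1) + p ^ 2 = p ^ 2 * p := by
      rw [← Nat.mul_succ, Nat.succ_eq_add_one, Nat.sub_add_cancel (by omega)]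
    have e2 : (p ^ 2 - 1) * p + p = p ^ 2 * p := by
      rw [Nat.sub_mul, one_mul, Nat.sub_add_cancel (Nat.le_mul_of_pos_left p (by positivity))]
    nlinarith
  have hstrict : ‖x‖ ^ ((p ^ 2 - 1) * p) < ‖x‖ ^ (p ^ 2 * (p - 1)) := pow_lt_pow_right_of_lt_one₀ hxpos hx1 hlt
  exact absurd (hle2.trans_lt (hle4.trans_lt hstrict)) (lt_irrefl _)

/-! ## §2 `θ(φ L_τ) ≠ 0` -/

/-- `b₁ = 1` for `b = formalLogNum W p` (`coeff_1 log_W = 1`). [cite: Colmez1992PeriodesAbeliennes, §2] -/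
theorem formalLogNum_one : GaloisContinuity.formalLogNum W p 1 = 1 := by
  apply Subtype.ext
  change (1 : ℚ_[p]) * PowerSeries.coeff 1 (W.map (Int.castRingHom ℚ_[p])).formalLog = 1
  rw [WeierstrassCurve.coeff_one_formalLog, mul_one]

/-- `θ⁰(ι[τ̃]) = 0`: Fontaine's element of a Tate-module point lies in `ker θ`. [cite: FontaineAsterisque223III, Exp. II §1.2.2] -/
theorem fontaineTheta_torsionLift_seq (τ : TatePt F p W) :
    WittVector.fontaineTheta (integerC F) p ((of F p).symm (torsionLift W hθ (seq W τ) (mulPC_seq W τ))) = 0 := by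
  have h := thetaBmaxZero_algebraMap_divisionLiftPt_eq_zero W (hθ := hθ) (mulPC_seq W τ)
    (by rw [seq_zero]; rfl)
  rwa [thetaBmaxZero_algebraMap, coe_val_divisionLiftPt] at h

set_option maxHeartbeats 1600000 in
/-- ★★★ **`θ_max(φ L_τ) ≠ 0`**: for `W/ℤ` with good supersingular reduction at `p ≥ 5`, `log_W` of Honda type `p − aT + T²` (`he`; `a = a_p`,
`BmaxPlusFormalLogDivisionTowerElliptic`), a Tate-module point `τ` with `‖p‖ < ‖u₁‖` and any witness `z` (`ι[τ̃] = p·z` in `B⁰_max`), the `φ`-partner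
`φ L_τ` of the `A_max`-period `L_τ = Λ_1(ι[τ̃], z)` is NOT in `ker θ`: otherwise `([ε] − 1) ∣ [τ̃]`
(`uAinf_dvd_of_thetaBmaxPlus_frobBmaxPlus_logSum_eq_zero`, using the exact relation `frobBmaxPlus_honda_logSum_divisionLiftPt_eq_zero`), contradicting
`not_uAinf_dvd_torsionLift`. [cite: Tate1967, §4] [cite: FontaineAsterisque223III, Exp. III Prop. 5.1.3] [cite: Colmez1992PeriodesAbeliennes, §2] -/
theorem thetaBmaxPlus_frobBmaxPlus_logSum_ne_zero (hp5 : 5 ≤ p) (hΔ : ¬ (p : ℤ) ∣ W.Δ)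
    (hA : (W.map (Int.castRingHom (ZMod p))).hasseCoeff p = 0) (a : ℤ_[p]) (e : ℕ → ℤ_[p])
    (he : ∀ m : ℕ, m ≠ 0 → (m : ℤ_[p]) * e m =
      GaloisContinuity.formalLogNum W p m - (if p ∣ m then a * GaloisContinuity.formalLogNum W p (m / p) else 0) +
        (if p ^ 2 ∣ m then (p : ℤ_[p]) * GaloisContinuity.formalLogNum W p (m / p ^ 2) else 0))
    (τ : TatePt F p W)
    (h₁ : ‖(p : CompletedAlgClosure F)‖ < ‖(((seq W τ 1 : (maxNilIdealC F).toIdeal) : CBall F) : CompletedAlgClosure F)‖)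
    {z : bmaxZero F p}
    (hz : algebraMap (Ainf (p := p) F) (bmaxZero F p)
        ((of F p).symm (((divisionLiftPt W hθ (seq W τ) (mulPC_seq W τ)).val : (nilTheta F p hθ).toIdeal) : AinfTop F p)) ^ 1 =
      (p : bmaxZero F p) * z) :
    thetaBmaxPlus F p (frobBmaxPlus F p
      (PadicLogSeries.logSum ((algebraMap (Ainf (p := p) F) (bmaxZero F p)).comp zpToAinf) (GaloisContinuity.formalLogNum W p) 1
        (algebraMap (Ainf (p := p) F) (bmaxZero F p)
          ((of F p).symm (((divisionLiftPt W hθ (seq W τ) (mulPC_seq W τ)).val : (nilTheta F p hθ).toIdeal) : AinfTop F p))) z)) ≠ 0 := by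
  have hp2 : p ≠ 2 := by omega
  intro h0
  have hrel := frobBmaxPlus_honda_logSum_divisionLiftPt_eq_zero W (hθ := hθ) a e he (mulPC_seq W τ) le_rfl hz
  have hy₀ : WittVector.fontaineTheta (integerC F) p
      ((of F p).symm (((divisionLiftPt W hθ (seq W τ) (mulPC_seq W τ)).val : (nilTheta F p hθ).toIdeal) : AinfTop F p)) = 0 := by
    rw [coe_val_divisionLiftPt]; exact fontaineTheta_torsionLift_seq W τ
  have hdvd := uAinf_dvd_of_thetaBmaxPlus_frobBmaxPlus_logSum_eq_zero hp2 (GaloisContinuity.formalLogNum W p) (formalLogNum_one W) hy₀ hz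
    hrel h0
  rw [coe_val_divisionLiftPt] at hdvd
  exact not_uAinf_dvd_torsionLift W hp5 hΔ hA τ h₁ hdvd

/-! ## §3 The witness -/

set_option maxHeartbeats 1600000 in
/-- ★★★ **Some `φ`-partner period leaves `ker θ`.** For `W/ℤ` with good supersingular reduction at `p ≥ 5` (`p ∤ Δ`, Hasse coefficient `0`;
`W ⊗ ℚ_p`, `W ⊗ 𝔽_p` elliptic for the Honda numerators with `a = a_p`) and every `p`-adic field `F`: there are `τ ∈ T_pŴ(𝒪_{ℂ_F})` and a witness `z`
(`ι[τ̃] = p·z`) with **`θ_max(φ L_τ) ≠ 0`**, `L_τ = Λ_1(ι[τ̃], z)` — the φ-road's `Pη = (B_max⁺ → B_dR⁺) ∘ φ ∘ L` is not `Fil¹`-valued on `T_pŴ`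
(the socket's `hnot`). Witness: any `τ` with `‖p‖ < ‖τ₁‖^p` (`exists_tatePt_norm_p_lt_norm_pow`). [cite: Tate1967, §4]
[cite: FontaineAsterisque223III, Exp. III Prop. 5.1.3] -/
theorem exists_thetaBmaxPlus_frobBmaxPlus_logSum_ne_zero (hp5 : 5 ≤ p) (hΔ : ¬ (p : ℤ) ∣ W.Δ)
    (hA : (W.map (Int.castRingHom (ZMod p))).hasseCoeff p = 0) [(W.map (Int.castRingHom ℚ_[p])).IsElliptic]
    [(W.map (Int.castRingHom (ZMod p))).IsElliptic] :
    ∃ (τ : TatePt F p W) (z : bmaxZero F p),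
      algebraMap (Ainf (p := p) F) (bmaxZero F p)
          ((of F p).symm (((divisionLiftPt W hθ (seq W τ) (mulPC_seq W τ)).val : (nilTheta F p hθ).toIdeal) : AinfTop F p)) ^ 1 =
        (p : bmaxZero F p) * z ∧
      thetaBmaxPlus F p (frobBmaxPlus F p
        (PadicLogSeries.logSum ((algebraMap (Ainf (p := p) F) (bmaxZero F p)).comp zpToAinf) (GaloisContinuity.formalLogNum W p) 1
          (algebraMap (Ainf (p := p) F) (bmaxZero F p)
            ((of F p).symm (((divisionLiftPt W hθ (seq W τ) (mulPC_seq W τ)).val : (nilTheta F p hθ).toIdeal) : AinfTop F p))) z)) ≠ 0 := by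
  have hp : p.Prime := Fact.out
  have hp2 : p ≠ 2 := by omega
  obtain ⟨τ, hτ1, hτ⟩ := exists_tatePt_norm_p_lt_norm_pow F p W hp2 hΔ hA
  have h₁ : ‖(p : CompletedAlgClosure F)‖ < ‖(((seq W τ 1 : (maxNilIdealC F).toIdeal) : CBall F) : CompletedAlgClosure F)‖ :=
    hτ.trans_le (by
      calc ‖(((seq W τ 1 : (maxNilIdealC F).toIdeal) : CBall F) : CompletedAlgClosure F)‖ ^ p
          ≤ ‖(((seq W τ 1 : (maxNilIdealC F).toIdeal) : CBall F) : CompletedAlgClosure F)‖ ^ 1 :=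
            pow_le_pow_of_le_one (norm_nonneg _) hτ1.le hp.pos
        _ = _ := pow_one _)
  -- a witness at index `1`: `‖τ₀‖^1 = 0 ≤ ‖p‖`
  have hN : ‖(((seq W τ 0 : (maxNilIdealC F).toIdeal) : CBall F) : CompletedAlgClosure F)‖ ^ 1 ≤ ‖(p : CompletedAlgClosure F)‖ := by
    rw [pow_one, seq_zero]; simp
  have hmem := pow_coe_val_nsmul_divisionLiftPt_mem W (hθ := hθ) (mulPC_seq W τ) hN 1
  rw [one_nsmul] at hmem
  obtain ⟨z, hz⟩ := exists_algebraMap_pow_eq_natCast_mul (F := F) (p := p) hmem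
  obtain ⟨e, he⟩ := exists_natCast_mul_eq_honda_formalLogNum (p := p) W
  exact ⟨τ, z, hz, thetaBmaxPlus_frobBmaxPlus_logSum_ne_zero W hp5 hΔ hA _ e he τ h₁ hz⟩

end AinfTop

end Literature.NumberTheory.PAdicHodge

end
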